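import Mathlib
import HarnessLib
import Summits.HubbardSuperconductivity.HubbardSuperconductivity.Theorems.KLProgrammeC4aPPKernelTrueFlatnessShape

/-!
# Route `KLProgramme` — crux C4a, S3 brick (B4) «(B4)-UMK1», «(M1)-TRUE-KERNEL» for the (U1)-LAWS INTERFACE: the POINTWISE ENVELOPES
# `|𝒦(e,u)| ≤ C₀/(e+u)`, `|∂ᵤ𝒦(e,u)| ≤ C₁/(e+u)²` of the true split kernel `𝒦(e,u) = N(e,u)·κ(e/(e+u))/(e+u)` (`e ≥ 0 < u`), `T`- and `Λ`-free constants

Cell `gate-hubbard-kl`, seat hubbard-kl-k3c3-p1 (g15; row «δμ-flow with klAngularMean constant piece»).  Serves k3c3-p3 g31's «(U1)-LAWS» (KL STATUS l.9981: the (M1)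
kernel enters the cover theorem's laws ONLY through the abstract envelopes `|K e u| ≤ (max e |u|)⁻¹`, `|(K e)′ u| ≤ (max e |u|)⁻²` of
`…C4aFoldBoxTwoSidedLaw.intervalIntegral_foldBox_twoSided_lawShape_le`, hypotheses `hK0`/`hK1`).  For the model-of-record numerator `N = ppTrueNumerator β Λ`
(`…C4aPPKernelTrueNumerator`) and a `C¹` split `κ` with `|κ| ≤ κ₀`, `|κ′| ≤ κ₁` on `[0,1]`, `κ = κ′ = 0` on `[t₁,∞)`, `t₁ < 1`:
* §1 `ppTrueNumerator_nonneg`, `ppTrueNumerator_le_one` (`0 ≤ N(e,u) ≤ 1` for `e,u ≥ 0`: termwise `0 ≤ WW(L_e+L_u) ≤ L_e+L_u`, `(2/β)ΣL_a = tanh(βa/2)/2`);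
  `abs_trueKernel_le`: `|𝒦(e,u)| ≤ κ₀/(e+u)`;
* §2 `trueKernelDu` (the `u`-derivative, certified by `…TrueFlatness.hasDerivAt_trueKernel_u`), `abs_ppTrueNumeratorDu_mul_le_of_support` (on the split's support
  `e < t₁(e+u)`: `|∂ᵤN(e,u)|·(e+u) ≤ (6B₁+5/2)/(1−t₁)` — far partner `u > Λ` by `|∂ᵤN| ≤ (β/4)sech²(βu/2) + Λ/u²` with `βu·e^{−βu} ≤ 1`, near partner by the
  uniform gradient bound), **`abs_trueKernelDu_le`**: `|∂ᵤ𝒦(e,u)| ≤ (κ₀(6B₁+5/2)/(1−t₁) + κ₀ + κ₁)/(e+u)²` for all `e ≥ 0 < u`;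
* §3 `max`-form corollaries `abs_trueKernel_le_inv_max`, `abs_trueKernelDu_le_inv_max_sq` (`(e+u)⁻¹ ≤ (max e |u|)⁻¹`): after dividing by the constant, the true
  split kernel satisfies `hK0`/`hK1` on `u > 0` VERBATIM.
Honest reading: (i) NO thermal layer — the UV weights vanish below the shell, so `sup|∂ᵤN| ≤ (6B₁+5/2)/Λ` and the far formula's `β/4·sech²` only appears at `u > Λ`
where `β(e+u)sech² ≤ 4/(1−t₁)`; (ii) the SPLIT is load-bearing: WITHOUT `κ`, `∂ᵤN(e,u) ↛ 0` as `e → ∞` at fixed `|u| ≲ Λ` (the `e`-independent piece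
`∂ᵤ[(2/β)ΣW(ωₙ,u)L(ωₙ,u)] = O(1/Λ)`), so `|∂ᵤ(N/(e+u))| ~ 1/(Λe) ≫ 1/e²` there — the unsplit kernel FAILS `hK1`; (iii) signed partner levels `u ≤ 0` are not covered
here (the split variable `e/(e+u)` degenerates) — magnitudes are the intended reading.
Pure real analysis; nothing asserts (C), K3 or superconductivity.
References: BGM 2006 §2.4 [cite: BenfattoGiulianiMastropietro2006]; FST 1998 §3 [cite: FeldmanSalmhoferTrubowitz1998].
-/

noncomputable section

namespace Summit.HubbardSuperconductivity.HubbardSuperconductivity.Theorems.C4a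

set_option linter.dupNamespace false -- summit = problem name (single-conjunct summit), D-0017

open Real Filter Set
open scoped Topology
open Literature.MathematicalPhysics.QuantumLattice Literature.Analysis.SpecialFunctions

/-! ## §1 `0 ≤ N ≤ 1` and the value envelope -/

/-- `0 ≤ W ≤ 1`. [cite: Salmhofer1999, §4.2.5 (4.70)] -/
theorem uvWeightFn_mem_Icc (Λ ω x : ℝ) : uvWeightFn Λ ω x ∈ Icc (0 : ℝ) 1 := by
  unfold uvWeightFn; exact salmhoferCutoff_mem_Icc _

/-- The summand of `N` lies between `0` and the free summand `L_e + L_u` (`e,u ≥ 0`). [cite: BenfattoGiulianiMastropietro2006, §2.4 (2.36)] -/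
theorem ppSummand_mem_Icc {β Λ e u : ℝ} (he : 0 ≤ e) (hu : 0 ≤ u) (n : ℕ) :
    uvWeightFn Λ (ppFreq β n) e * uvWeightFn Λ (ppFreq β n) u * (e / (ppFreq β n ^ 2 + e ^ 2) + u / (ppFreq β n ^ 2 + u ^ 2)) ∈
      Icc (0 : ℝ) (e / (ppFreq β n ^ 2 + e ^ 2) + u / (ppFreq β n ^ 2 + u ^ 2)) := by
  obtain ⟨h1, h2⟩ := uvWeightFn_mem_Icc Λ (ppFreq β n) e
  obtain ⟨h3, h4⟩ := uvWeightFn_mem_Icc Λ (ppFreq β n) u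
  have hL : 0 ≤ e / (ppFreq β n ^ 2 + e ^ 2) + u / (ppFreq β n ^ 2 + u ^ 2) := add_nonneg (lorentzian_nonneg _ he) (lorentzian_nonneg _ hu)
  refine ⟨by positivity, ?_⟩
  calc uvWeightFn Λ (ppFreq β n) e * uvWeightFn Λ (ppFreq β n) u * (e / (ppFreq β n ^ 2 + e ^ 2) + u / (ppFreq β n ^ 2 + u ^ 2))
      ≤ 1 * 1 * (e / (ppFreq β n ^ 2 + e ^ 2) + u / (ppFreq β n ^ 2 + u ^ 2)) := by gcongr
    _ = _ := by ring

/-- The free summand is summable and sums to `(β/4)(tanh(βe/2) + tanh(βu/2))`. [cite: BenfattoGiulianiMastropietro2006, §2.1 (2.5)] -/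
theorem hasSum_free_ppSummand {β : ℝ} (hβ : 0 < β) (e u : ℝ) :
    HasSum (fun n : ℕ => e / (ppFreq β n ^ 2 + e ^ 2) + u / (ppFreq β n ^ 2 + u ^ 2)) (β / 4 * Real.tanh (β * e / 2) + β / 4 * Real.tanh (β * u / 2)) := by
  have hs : ∀ a : ℝ, Summable fun n : ℕ => a / (ppFreq β n ^ 2 + a ^ 2) := fun a =>
    ((summable_one_div_ppFreq_sq_add_sq hβ a).mul_left a).congr fun n => by ring
  have hv : ∀ a : ℝ, ∑' n : ℕ, a / (ppFreq β n ^ 2 + a ^ 2) = β / 4 * Real.tanh (β * a / 2) := fun a => by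
    simpa [ppFreq] using tsum_matsubara_lorentzian hβ a
  have h := ((hs e).hasSum).add ((hs u).hasSum)
  rwa [hv e, hv u] at h

/-- **`0 ≤ N(e,u)`** for `e, u ≥ 0`. [cite: BenfattoGiulianiMastropietro2006, §2.4 (2.36)] -/
theorem ppTrueNumerator_nonneg {β Λ e u : ℝ} (hβ : 0 < β) (he : 0 ≤ e) (hu : 0 ≤ u) : 0 ≤ ppTrueNumerator β Λ e u := by
  unfold ppTrueNumerator
  exact mul_nonneg (by positivity) (tsum_nonneg fun n => (ppSummand_mem_Icc (β := β) (Λ := Λ) he hu n).1)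

/-- **`N(e,u) ≤ 1`** for `e, u ≥ 0` (`N ≤ N_free = (tanh(βe/2) + tanh(βu/2))/2 ≤ 1`). [cite: BenfattoGiulianiMastropietro2006, §2.4 (2.36)] -/
theorem ppTrueNumerator_le_one {β Λ e u : ℝ} (hβ : 0 < β) (he : 0 ≤ e) (hu : 0 ≤ u) : ppTrueNumerator β Λ e u ≤ 1 := by
  have hfree := hasSum_free_ppSummand hβ e u
  have hsW : Summable fun n : ℕ => uvWeightFn Λ (ppFreq β n) e * uvWeightFn Λ (ppFreq β n) u *
      (e / (ppFreq β n ^ 2 + e ^ 2) + u / (ppFreq β n ^ 2 + u ^ 2)) :=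
    Summable.of_nonneg_of_le (fun n => (ppSummand_mem_Icc he hu n).1) (fun n => (ppSummand_mem_Icc he hu n).2) hfree.summable
  have hle : ∑' n : ℕ, uvWeightFn Λ (ppFreq β n) e * uvWeightFn Λ (ppFreq β n) u * (e / (ppFreq β n ^ 2 + e ^ 2) + u / (ppFreq β n ^ 2 + u ^ 2)) ≤
      β / 4 * Real.tanh (β * e / 2) + β / 4 * Real.tanh (β * u / 2) := by
    rw [← hfree.tsum_eq]
    exact hsW.tsum_le_tsum (fun n => (ppSummand_mem_Icc he hu n).2) hfree.summable
  have ht1 : Real.tanh (β * e / 2) ≤ 1 := (Real.tanh_lt_one _).le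
  have ht2 : Real.tanh (β * u / 2) ≤ 1 := (Real.tanh_lt_one _).le
  unfold ppTrueNumerator
  calc 2 / β * ∑' n : ℕ, uvWeightFn Λ (ppFreq β n) e * uvWeightFn Λ (ppFreq β n) u * (e / (ppFreq β n ^ 2 + e ^ 2) + u / (ppFreq β n ^ 2 + u ^ 2))
      ≤ 2 / β * (β / 4 * Real.tanh (β * e / 2) + β / 4 * Real.tanh (β * u / 2)) := mul_le_mul_of_nonneg_left hle (by positivity)
    _ = (Real.tanh (β * e / 2) + Real.tanh (β * u / 2)) / 2 := by field_simp; ring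
    _ ≤ 1 := by linarith

/-- **THE VALUE ENVELOPE**: `|N(e,u)·κ(e/(e+u))/(e+u)| ≤ κ₀/(e+u)` for `e ≥ 0`, `u ≥ 0`, `e+u > 0`, `|κ| ≤ κ₀` on `[0,1]`.
[cite: BenfattoGiulianiMastropietro2006, §2.4 (2.36)] -/
theorem abs_trueKernel_le {β Λ e u : ℝ} (hβ : 0 < β) (he : 0 ≤ e) (hu : 0 ≤ u) (hs : 0 < e + u) {κ : ℝ → ℝ} {κ₀ : ℝ}
    (hκb : ∀ t ∈ Icc 0 1, |κ t| ≤ κ₀) : |ppTrueNumerator β Λ e u * κ (e / (e + u)) / (e + u)| ≤ κ₀ / (e + u) := by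
  have ht : e / (e + u) ∈ Icc (0 : ℝ) 1 := ⟨div_nonneg he hs.le, (div_le_one hs).2 (by linarith)⟩
  have hN0 := ppTrueNumerator_nonneg (Λ := Λ) hβ he hu
  have hN1 := ppTrueNumerator_le_one (Λ := Λ) hβ he hu
  rw [abs_div, abs_mul, abs_of_pos hs, abs_of_nonneg hN0]
  refine div_le_div_of_nonneg_right ?_ hs.le
  calc ppTrueNumerator β Λ e u * |κ (e / (e + u))| ≤ 1 * κ₀ := mul_le_mul hN1 (hκb _ ht) (abs_nonneg _) zero_le_one
    _ = κ₀ := one_mul _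

/-! ## §2 The derivative envelope -/

/-- The `u`-derivative of the true split kernel: `∂ᵤ𝒦(e,u) = ∂ᵤN·κ(e/(e+u))/(e+u) − N·(κ′(e/(e+u))·e/(e+u) + κ(e/(e+u)))/(e+u)²`. -/
def trueKernelDu (β Λ : ℝ) (κ κ' : ℝ → ℝ) (e u : ℝ) : ℝ :=
  ppTrueNumeratorDu β Λ e u * κ (e / (e + u)) / (e + u) - ppTrueNumerator β Λ e u * (κ' (e / (e + u)) * (e / (e + u)) + κ (e / (e + u))) / (e + u) ^ 2

/-- `trueKernelDu` IS the `u`-derivative (`e + u ≠ 0`). [cite: BenfattoGiulianiMastropietro2006, §2.4 (2.36)] -/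
theorem hasDerivAt_trueKernel_u' {β Λ : ℝ} (hβ : 0 < β) (hΛ : 0 < Λ) {B₁ : ℝ} (hB₁ : ∀ x, |deriv salmhoferCutoff x| ≤ B₁) {κ κ' : ℝ → ℝ}
    (hκ : ∀ t, HasDerivAt κ (κ' t) t) {e u : ℝ} (hs : e + u ≠ 0) :
    HasDerivAt (fun v : ℝ => ppTrueNumerator β Λ e v * κ (e / (e + v)) / (e + v)) (trueKernelDu β Λ κ κ' e u) u := by
  have h := hasDerivAt_trueKernel_u hβ hΛ hB₁ hκ (D := e + u) hs e
  rw [add_sub_cancel_left] at h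
  exact h

/-- **On the split's support the partner-level gradient pays one power of `e+u`**: `0 ≤ e`, `0 < u`, `(1−t₁)(e+u) ≤ u` ⟹
`|∂ᵤN(e,u)|·(e+u) ≤ (6B₁+5/2)/(1−t₁)` — far partner (`Λ < u`) by `(β/4)sech²(βu/2) + Λ/u²` and `β(e+u)·sech² ≤ 4βu·e^{−βu}/(1−t₁) ≤ 4/(1−t₁)`,
near partner (`u ≤ Λ`) by the uniform gradient `(6B₁+5/2)/Λ` and `e+u ≤ Λ/(1−t₁)`. [cite: BenfattoGiulianiMastropietro2006, §2.4 (2.36)] -/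
theorem abs_ppTrueNumeratorDu_mul_le_of_support {β Λ : ℝ} (hβ : 0 < β) (hΛ : 0 < Λ) {B₁ : ℝ} (hB₁ : ∀ x, |deriv salmhoferCutoff x| ≤ B₁) {t₁ e u : ℝ}
    (ht₁ : t₁ < 1) (he : 0 ≤ e) (hu : 0 < u) (hsupp : (1 - t₁) * (e + u) ≤ u) :
    |ppTrueNumeratorDu β Λ e u| * (e + u) ≤ (6 * B₁ + 5 / 2) / (1 - t₁) := by
  have hB0 := salmhoferB₁_nonneg hB₁
  have h1t : 0 < 1 - t₁ := by linarith
  have hs : 0 < e + u := by linarith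
  have hsu : e + u ≤ u / (1 - t₁) := by rw [le_div_iff₀ h1t]; linarith
  rcases le_or_gt u Λ with hnear | hfar
  · -- near partner: uniform gradient
    have hg := abs_ppTrueNumeratorDu_le_unif hβ hΛ hB₁ e u
    calc |ppTrueNumeratorDu β Λ e u| * (e + u) ≤ (6 * B₁ + 5 / 2) / Λ * (u / (1 - t₁)) := mul_le_mul hg hsu hs.le (by positivity)
      _ ≤ (6 * B₁ + 5 / 2) / Λ * (Λ / (1 - t₁)) := by gcongr
      _ = (6 * B₁ + 5 / 2) / (1 - t₁) := by field_simp
  · -- far partner: full-orbit cancellation + defect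
    have hg := abs_ppTrueNumeratorDu_far_le hβ hΛ hfar e
    have hsech : sech (β * u / 2) ^ 2 ≤ 4 * Real.exp (-(β * u)) := sech_half_sq_le_four_exp_neg (by positivity)
    have hxe : β * u * Real.exp (-(β * u)) ≤ 1 := by
      -- `x·e^{−x} ≤ 1` (also `Literature.NumberTheory.Automorphic.SelbergDecay.mul_exp_neg_le_one`; inlined to keep the import closure physical)
      have h1 : β * u ≤ Real.exp (β * u) := by linarith [Real.add_one_le_exp (β * u)]
      calc β * u * Real.exp (-(β * u)) ≤ Real.exp (β * u) * Real.exp (-(β * u)) := mul_le_mul_of_nonneg_right h1 (Real.exp_pos _).le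
        _ = 1 := by rw [← Real.exp_add, add_neg_cancel, Real.exp_zero]
    have hA : β / 4 * sech (β * u / 2) ^ 2 * (e + u) ≤ 1 / (1 - t₁) := by
      calc β / 4 * sech (β * u / 2) ^ 2 * (e + u) ≤ β / 4 * (4 * Real.exp (-(β * u))) * (u / (1 - t₁)) := by gcongr
        _ = β * u * Real.exp (-(β * u)) / (1 - t₁) := by ring
        _ ≤ 1 / (1 - t₁) := div_le_div_of_nonneg_right hxe h1t.le
    have hB : Λ / u ^ 2 * (e + u) ≤ 1 / (1 - t₁) := by
      calc Λ / u ^ 2 * (e + u) ≤ Λ / u ^ 2 * (u / (1 - t₁)) := by gcongr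
        _ = Λ / u / (1 - t₁) := by field_simp
        _ ≤ 1 / (1 - t₁) := div_le_div_of_nonneg_right ((div_le_one hu).2 hfar.le) h1t.le
    have h52 : 2 / (1 - t₁) ≤ (6 * B₁ + 5 / 2) / (1 - t₁) := div_le_div_of_nonneg_right (by linarith) h1t.le
    calc |ppTrueNumeratorDu β Λ e u| * (e + u) ≤ (β / 4 * sech (β * u / 2) ^ 2 + Λ / u ^ 2) * (e + u) := mul_le_mul_of_nonneg_right hg hs.le
      _ = β / 4 * sech (β * u / 2) ^ 2 * (e + u) + Λ / u ^ 2 * (e + u) := by ring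
      _ ≤ 1 / (1 - t₁) + 1 / (1 - t₁) := add_le_add hA hB
      _ = 2 / (1 - t₁) := by ring
      _ ≤ (6 * B₁ + 5 / 2) / (1 - t₁) := h52

/-- **THE DERIVATIVE ENVELOPE.**  `0 < β`, `0 < Λ`, `|χ′| ≤ B₁`; split `|κ| ≤ κ₀`, `|κ′| ≤ κ₁` on `[0,1]`, `κ = κ′ = 0` on `[t₁,∞)`, `t₁ < 1`.  THEN for all `e ≥ 0 < u`:
`|∂ᵤ𝒦(e,u)| ≤ (κ₀(6B₁+5/2)/(1−t₁) + κ₀ + κ₁)/(e+u)²` — temperature- and scale-free. [cite: BenfattoGiulianiMastropietro2006, §2.4 (2.36)] -/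
theorem abs_trueKernelDu_le {β Λ : ℝ} (hβ : 0 < β) (hΛ : 0 < Λ) {B₁ : ℝ} (hB₁ : ∀ x, |deriv salmhoferCutoff x| ≤ B₁) {κ κ' : ℝ → ℝ} {κ₀ κ₁ t₁ : ℝ}
    (hκb : ∀ t ∈ Icc 0 1, |κ t| ≤ κ₀) (hκ'b : ∀ t ∈ Icc 0 1, |κ' t| ≤ κ₁) (ht₁ : t₁ < 1) (hκs : ∀ t, t₁ ≤ t → κ t = 0) (hκ's : ∀ t, t₁ ≤ t → κ' t = 0)
    {e u : ℝ} (he : 0 ≤ e) (hu : 0 < u) :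
    |trueKernelDu β Λ κ κ' e u| ≤ (κ₀ * ((6 * B₁ + 5 / 2) / (1 - t₁)) + κ₀ + κ₁) / (e + u) ^ 2 := by
  have hB0 := salmhoferB₁_nonneg hB₁
  have h1t : 0 < 1 - t₁ := by linarith
  have hs : 0 < e + u := by linarith
  have hκ₀ : 0 ≤ κ₀ := (abs_nonneg _).trans (hκb 0 (left_mem_Icc.2 zero_le_one))
  have hκ₁ : 0 ≤ κ₁ := (abs_nonneg _).trans (hκ'b 0 (left_mem_Icc.2 zero_le_one))
  set t : ℝ := e / (e + u) with htdef
  have ht : t ∈ Icc (0 : ℝ) 1 := ⟨div_nonneg he hs.le, (div_le_one hs).2 (by linarith)⟩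
  by_cases hsupp : t₁ ≤ t
  · -- off the support: the kernel vanishes identically to first order
    have h0 : trueKernelDu β Λ κ κ' e u = 0 := by
      unfold trueKernelDu; rw [← htdef, hκs t hsupp, hκ's t hsupp]; ring
    rw [h0, abs_zero]; positivity
  · -- on the support: `(1 − t₁)(e+u) ≤ u`
    have hlt : t < t₁ := not_le.1 hsupp
    have hsupp' : (1 - t₁) * (e + u) ≤ u := by
      have h1 : e < t₁ * (e + u) := by rwa [htdef, div_lt_iff₀ hs] at hlt
      nlinarith
    have hN0 := ppTrueNumerator_nonneg (Λ := Λ) hβ he hu.le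
    have hN1 := ppTrueNumerator_le_one (Λ := Λ) hβ he hu.le
    have hDu := abs_ppTrueNumeratorDu_mul_le_of_support hβ hΛ hB₁ ht₁ he hu hsupp'
    have hk := hκb t ht
    have hk' := hκ'b t ht
    -- piece A
    have hA : |ppTrueNumeratorDu β Λ e u * κ t / (e + u)| ≤ κ₀ * ((6 * B₁ + 5 / 2) / (1 - t₁)) / (e + u) ^ 2 := by
      rw [abs_div, abs_mul, abs_of_pos hs, div_le_div_iff₀ hs (pow_pos hs 2)]
      calc |ppTrueNumeratorDu β Λ e u| * |κ t| * (e + u) ^ 2 = (|ppTrueNumeratorDu β Λ e u| * (e + u)) * |κ t| * (e + u) := by ring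
        _ ≤ (6 * B₁ + 5 / 2) / (1 - t₁) * κ₀ * (e + u) := by gcongr
        _ = κ₀ * ((6 * B₁ + 5 / 2) / (1 - t₁)) * (e + u) := by ring
    -- piece B
    have hB : |ppTrueNumerator β Λ e u * (κ' t * t + κ t) / (e + u) ^ 2| ≤ (κ₁ + κ₀) / (e + u) ^ 2 := by
      rw [abs_div, abs_mul, abs_of_pos (pow_pos hs 2), abs_of_nonneg hN0]
      refine div_le_div_of_nonneg_right ?_ (pow_pos hs 2).le
      have h1 : |κ' t * t + κ t| ≤ κ₁ + κ₀ := by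
        refine (abs_add_le _ _).trans (add_le_add ?_ hk)
        rw [abs_mul, abs_of_nonneg ht.1]
        calc |κ' t| * t ≤ κ₁ * 1 := mul_le_mul hk' ht.2 ht.1 hκ₁
          _ = κ₁ := mul_one _
      calc ppTrueNumerator β Λ e u * |κ' t * t + κ t| ≤ 1 * (κ₁ + κ₀) := mul_le_mul hN1 h1 (abs_nonneg _) zero_le_one
        _ = κ₁ + κ₀ := one_mul _
    unfold trueKernelDu
    rw [← htdef]
    refine (abs_sub _ _).trans ((add_le_add hA hB).trans (le_of_eq ?_))
    ring

/-! ## §3 The `max`-form of the (U1)-LAWS hypotheses -/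

/-- `(e+u)⁻¹ ≤ (max e |u|)⁻¹` for `e ≥ 0 < u`. [folklore] -/
theorem inv_add_le_inv_max {e u : ℝ} (he : 0 ≤ e) (hu : 0 < u) : 1 / (e + u) ≤ (max e |u|)⁻¹ := by
  rw [abs_of_pos hu, ← one_div]
  exact one_div_le_one_div_of_le (lt_max_of_lt_right hu) (max_le (by linarith) (by linarith))

/-- **`hK0` for the true split kernel** (`e ≥ 0 < u`): `|𝒦(e,u)| ≤ κ₀·(max e |u|)⁻¹`. [cite: BenfattoGiulianiMastropietro2006, §2.4 (2.36)] -/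
theorem abs_trueKernel_le_inv_max {β Λ e u : ℝ} (hβ : 0 < β) (he : 0 ≤ e) (hu : 0 < u) {κ : ℝ → ℝ} {κ₀ : ℝ} (hκb : ∀ t ∈ Icc 0 1, |κ t| ≤ κ₀) :
    |ppTrueNumerator β Λ e u * κ (e / (e + u)) / (e + u)| ≤ κ₀ * (max e |u|)⁻¹ := by
  have hκ₀ : 0 ≤ κ₀ := (abs_nonneg _).trans (hκb 0 (left_mem_Icc.2 zero_le_one))
  refine (abs_trueKernel_le hβ he hu.le (by linarith) hκb).trans ?_
  rw [div_eq_mul_one_div]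
  exact mul_le_mul_of_nonneg_left (inv_add_le_inv_max he hu) hκ₀

/-- **`hK1` for the true split kernel** (`e ≥ 0 < u`): `|∂ᵤ𝒦(e,u)| ≤ (κ₀(6B₁+5/2)/(1−t₁) + κ₀ + κ₁)·(max e |u|)⁻¹²`.
[cite: BenfattoGiulianiMastropietro2006, §2.4 (2.36)] -/
theorem abs_trueKernelDu_le_inv_max_sq {β Λ : ℝ} (hβ : 0 < β) (hΛ : 0 < Λ) {B₁ : ℝ} (hB₁ : ∀ x, |deriv salmhoferCutoff x| ≤ B₁) {κ κ' : ℝ → ℝ}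
    {κ₀ κ₁ t₁ : ℝ} (hκb : ∀ t ∈ Icc 0 1, |κ t| ≤ κ₀) (hκ'b : ∀ t ∈ Icc 0 1, |κ' t| ≤ κ₁) (ht₁ : t₁ < 1) (hκs : ∀ t, t₁ ≤ t → κ t = 0)
    (hκ's : ∀ t, t₁ ≤ t → κ' t = 0) {e u : ℝ} (he : 0 ≤ e) (hu : 0 < u) :
    |trueKernelDu β Λ κ κ' e u| ≤ (κ₀ * ((6 * B₁ + 5 / 2) / (1 - t₁)) + κ₀ + κ₁) * (max e |u|)⁻¹ ^ 2 := by
  have hB0 := salmhoferB₁_nonneg hB₁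
  have h1t : 0 < 1 - t₁ := by linarith
  have hκ₀ : 0 ≤ κ₀ := (abs_nonneg _).trans (hκb 0 (left_mem_Icc.2 zero_le_one))
  have hκ₁ : 0 ≤ κ₁ := (abs_nonneg _).trans (hκ'b 0 (left_mem_Icc.2 zero_le_one))
  have hC : 0 ≤ κ₀ * ((6 * B₁ + 5 / 2) / (1 - t₁)) + κ₀ + κ₁ := by positivity
  refine (abs_trueKernelDu_le hβ hΛ hB₁ hκb hκ'b ht₁ hκs hκ's he hu).trans ?_
  have h1 := inv_add_le_inv_max he hu
  have h2 : 1 / (e + u) ^ 2 ≤ (max e |u|)⁻¹ ^ 2 := by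
    have h0 : 0 ≤ 1 / (e + u) := by positivity
    calc 1 / (e + u) ^ 2 = (1 / (e + u)) ^ 2 := by rw [one_div_pow]
      _ ≤ (max e |u|)⁻¹ ^ 2 := pow_le_pow_left₀ h0 h1 2
  rw [div_eq_mul_one_div]
  exact mul_le_mul_of_nonneg_left h2 hC

end Summit.HubbardSuperconductivity.HubbardSuperconductivity.Theorems.C4a

end
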